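import Literature.Barriers.NavierStokesRegularity.EnergyDispersalNoEnstrophyControl

/-!
# The energy-dispersal barrier holds — `EnergyDispersal.EnergyDispersalNoEnstrophyControl` under its exact name

Trunk: Barriers / NavierStokesRegularity (Doering–Gibbon 1995 §6.3; Tao 2007, supercriticality).

The barrier `Literature.Barriers.NavierStokesRegularity.EnergyDispersal.EnergyDispersalNoEnstrophyControl`
(no law `R(u)² · X(u) ≤ C · E(u)` with a length `R` read off the energy density `|u|²`: for every radius
`r > 0` and constant `C` there is a smooth compactly supported divergence-free `u` whose energy is
`r`-dispersed in every ball and yet `C ∫|u|² ≤ r² ∫|∇u|²_F`) is PROVED in the tree by the kernel theorem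
`energyDispersalNoEnstrophyControl_holds` of `EnergyDispersalNoEnstrophyControl.lean` (the two-scale
witness `twoScale θ L λ`).  That theorem carries the fact's name with a lower-case initial, so the tree's
exact-name convention `X_holds` next to `X` was not met and the ledger's debt table still listed the
fact unproved (`ledger fact claim` GRANTED «status unproved», 2026-08-29T05:17Z, 39 h after the proof
landed).  This leaf gives the fact its exact `_holds` name (D-0026 bookkeeping: the proof term is the
existing theorem; no statement, definition or attribute is edited; no new named fact).

## References

* C. R. Doering, J. D. Gibbon, *Applied Analysis of the Navier–Stokes Equations*, Cambridge Texts in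
  Applied Mathematics, CUP 1995, §6.3, (6.3.4)–(6.3.8), pp. 125–127. [DoeringGibbon1995]
* T. Tao, *Why global regularity for Navier–Stokes is hard* (2007), the supercriticality paragraph
  (rescaling `u^{(λ)}`). [Tao2007WhyNSHard]
-/

namespace Literature.Barriers.NavierStokesRegularity.EnergyDispersal

/-- **The energy-dispersal barrier holds**, under the fact's exact name: the tree's kernel theorem
`energyDispersalNoEnstrophyControl_holds` (two-scale witness).
[cite: DoeringGibbon1995, §6.3 (6.3.4)–(6.3.8) pp.125–127]
[cite: Tao2007WhyNSHard, supercriticality paragraph (rescaling `u^{(λ)}`)] -/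
theorem EnergyDispersalNoEnstrophyControl_holds :
    _root_.Literature.Barriers.NavierStokesRegularity.EnergyDispersal.EnergyDispersalNoEnstrophyControl :=
  _root_.Literature.Barriers.NavierStokesRegularity.EnergyDispersal.energyDispersalNoEnstrophyControl_holds

end Literature.Barriers.NavierStokesRegularity.EnergyDispersal
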